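import Literature.AlgebraicGeometry.Resolution.BlowupAlgebraStrictTransform
import Literature.AlgebraicGeometry.Resolution.BlowupAlgebraQuasiRegularChart
import Literature.AlgebraicGeometry.Resolution.RegularLocalRingsJacobian
import Literature.AlgebraicGeometry.Resolution.AdicCompletionRegular
import Summits.ResolutionOfSingularities.ResolutionOfSingularities.Theorems.EquisingularLiftEquisingularLiftNatConeDeltaRegularCarrier
import HarnessLib

/-!
# [OURS · L1 W4.5(b) · EL♮] K-RIBBON: a RIBBON touch (relative dimension 3, multiplicity `m ≥ 2`) at an
# ANISOTROPIC good 2-dimensional germ is never the finishing touch — ring form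
# (crux `EquisingularLiftNat` = stmt-ResolutionOfSingularities-20038; K-∀n / K5-BMY necessity lane, kill test #50)

HONEST FRAMING. OURS (cell res-hironaka, crux chain w45b, slot W4.5(b)); NOT a statement of any manuscript; replaces the
role of NOTHING in the manuscript; AI-written, AI review is weaker than expert review. Helper `--supports
stmt-ResolutionOfSingularities-20038 --as helper`. Object K-RIBBON of res-L1-w45b-strat-1's STRATEGY-CENSUS v10
(sha16 0ed0c3dd766d6f34) §4 (N5.1) / §5 R2″, the `r = 3` twin of `…NatFatTouchNotFinishing` (p522183, `r = 2`).

THE SITUATION (N5.1, at the generic point `x_j` of the singular surface, one dimension down after `ϖ = 0`).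
`R = 𝒪_{P_s, x_j}` is a regular local ring of dimension `3` with regular system of parameters `(u₁, u₂, t)`;
`A = R/(g) = 𝒪_{Y_j, x_j}` with `g ∈ 𝔪²` and `g ≡ ε·t² (mod (u₁, u₂))`, `ε` a unit — this is the clause
«`q(0,0,1) ≠ 0`» of the ANISOTROPIC tangent conic `q`; a RIBBON touch is an `O`-flat regular centre
`C = V(u₁, u₂, ϖ − ε′t^m)`, `m ≥ 2`, whose trace on `A` is `(ū₁, ū₂, t̄^m)·A = (ū₁, ū₂)·A` (because `t̄² ∈ (ū₁, ū₂)A`,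
`trace_eq` below). The strict transform of `Y_j` is the blow-up of `Spec A` along `(ū₁, ū₂)`; its `ū₁`-chart is the
affine blow-up algebra `A[(ū₁, ū₂)/ū₁]` (tree `blowupAlgebra`).

THE THEOREM (`exists_prime_not_isRegularLocalRing`; N5.1 by hand, here sorry-free): `A[(ū₁, ū₂)/ū₁]` has a prime `𝔓` over `𝔪_A`
whose local ring is NOT regular. Proof: `B := R[(u₁,u₂)/u₁]` is a regular ring (`isRegularRing_blowupAlgebra`, Liu 8.1.19) with
`B/(u₁) ≅ (R/(u₁,u₂))[T]` (`blowupAlgebraQuotEquiv`, Stacks 0BIQ), so `u₁` is prime in `B`, `u₁ ∤ g` (image the constant `ε̄ t̄² ≠ 0`)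
and `𝔮 := 𝔪_R·B` is prime (`B/𝔮 ≅ F[T]`); the strict transform's chart is `B/(g)` (`blowupAlgebra.ker_mapQuotient_eq_span`, exponent
`0`, Görtz–Wedhorn 13.96 (2)); its local ring at `𝔮` is `B_𝔮/(g)` with `0 ≠ g ∈ 𝔮²` — not regular (Matsumura 14.2,
`not_isRegularLocalRing_quotient_span_singleton_of_mem_sq`; localisation vs quotient: `TCPlus.isLocalization_atPrime_…`, p535712).

GEOMETRY (N5.1): `𝔓` = generic point `η″` of the exceptional `ℙ¹_F` over `x_j` (strict transform non-normal there); with p522183 /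
p525849 the finishing touch at an anisotropic good 2-dim germ has `(r, m) = (3, 1)`. Refs: [GortzWedhorn2020, 13.96], [Matsumura1987, 14.2].
-/

set_option linter.dupNamespace false -- mandated namespace `Summit.<Summit>.<Problem>` of this single-conjunct summit

noncomputable section

universe u

open IsLocalRing Literature.AlgebraicGeometry.Resolution

namespace Summit.ResolutionOfSingularities.ResolutionOfSingularities.Cruxes.EquisingularLiftNat.Sections

namespace RibbonTouch

variable {R : Type u} [CommRing R] [IsRegularLocalRing R] (c : Fin 2 → R) (t : R)
  (hz : Ideal.span (Set.range (Fin.append c ![t])) = maximalIdeal R)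
  (hd : (maximalIdeal R).spanFinrank = 2 + 1)

local notation3 "I" => Ideal.span (Set.range c)
local notation3 "B" => blowupAlgebra (Ideal.span (Set.range c)) (c 0)
local notation3 "P₂" => MvPolynomial {j : Fin 2 // j ≠ 0} (R ⧸ Ideal.span (Set.range c))
local notation3 "B₀" => (blowupAlgebra (Ideal.span (Set.range c)) (c 0) ⧸
  Ideal.span {algebraMap R (blowupAlgebra (Ideal.span (Set.range c)) (c 0)) (c 0)})

/-! ## The regular local ring `R` with regular system of parameters `(c₀, c₁, t)` -/

include hz hd in
/-- `t ∉ (c₀, c₁)`: a member of a regular system of parameters is not in the ideal of the others. [folklore] -/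
theorem t_notMem_span : t ∉ I := by
  have hfull : IsRsopPart (Fin.append c ![t]) :=
    ⟨inferInstance, 0, Fin.elim0, by
      rw [← IsRegularLocalRing.spanFinrank_maximalIdeal, hd], by
      rw [← hz]; congr 1; ext x; simp⟩
  have h := hfull.not_mem_span_image (S := Set.range (Fin.castAdd 1)) (i := Fin.natAdd 2 0)
    (by rintro ⟨j, hj⟩; exact absurd (congrArg Fin.val hj) (by simp; omega))
  have himg : Fin.append c ![t] '' Set.range (Fin.castAdd 1) = Set.range c := by
    ext x
    simp only [Set.mem_image, Set.mem_range, exists_exists_eq_and, Fin.append_left]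
  rw [himg, Fin.append_right] at h
  simpa using h

include hz hd in
/-- `(c₀, c₁)` is a prime ideal of `R`. [cite: Matsumura1987, Thm. 14.3] -/
theorem isPrime_span : (I).IsPrime :=
  (isRsopPart_centre c ![t] hz hd).isPrime_span_range

include hz hd in
/-- `R/(c₀, c₁)` is a domain. [cite: Matsumura1987, Thm. 14.3] -/
theorem isDomain_quot : IsDomain (R ⧸ I) :=
  haveI := isRegularLocalRing_quot_centre c ![t] hz hd
  isDomain_of_isRegularLocalRing _

include hz hd in
/-- **The chart `B = R[(c₀,c₁)/c₀]` is a regular ring** (Liu 8.1.19 (a), tree `isRegularRing_blowupAlgebra`).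
[cite: Liu2002, Thm. 8.1.19 (a)] -/
theorem isRegularRing_chart : IsRegularRing B := by
  haveI := isRegularRing_of_isRegularLocalRing R
  haveI := isRegularLocalRing_quot_centre c ![t] hz hd
  haveI : IsRegularRing (R ⧸ I) := isRegularRing_of_isRegularLocalRing _
  exact isRegularRing_blowupAlgebra c 0 (isQuasiRegular_centre c ![t] hz hd)

/-- `B` is a domain (a subring of `R[1/c₀]`, `R` a domain). [folklore] -/
theorem isDomain_chart (hc0 : c 0 ≠ 0) : IsDomain B := by
  haveI := isDomain_of_isRegularLocalRing R
  haveI : IsDomain (Localization.Away (c 0)) :=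
    IsLocalization.isDomain_localization (powers_le_nonZeroDivisors_of_noZeroDivisors hc0)
  infer_instance

include hz hd in
/-- `c₀ ≠ 0`. [folklore] -/
theorem c0_ne_zero : c 0 ≠ 0 :=
  (isRsopPart_centre c ![t] hz hd).ne_zero 0

/-! ## `B/(c₀) ≅ (R/(c₀,c₁))[T]`: `c₀` is prime in `B`, `𝔪_R B` is prime, `c₀ ∤ g` -/

section Quot

variable {c t}

omit [IsRegularLocalRing R] in
/-- The chart isomorphism `(R/I)[T] ≅ B/(c₀)` pulls `r/1 mod c₀` back to the constant `r̄`. [cite: StacksProject, Tag 0BIQ] -/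
theorem quotEquiv_symm_mk_algebraMap (hc : IsQuasiRegular c) (r : R) :
    (blowupAlgebraQuotEquiv c 0 hc).symm (Ideal.Quotient.mk _ (algebraMap R B r)) =
      MvPolynomial.C (Ideal.Quotient.mk I r) := by
  apply (blowupAlgebraQuotEquiv c 0 hc).injective
  rw [RingEquiv.apply_symm_apply, blowupAlgebraQuotEquiv_C]

include hz hd in
/-- **`c₀` is a prime element of `B`** (`B/(c₀) ≅ (R/(c₀,c₁))[T]` is a domain). [cite: StacksProject, Tag 0BIQ] -/
theorem prime_algebraMap_c0 : Prime (algebraMap R B (c 0)) := by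
  have hc := isQuasiRegular_centre c ![t] hz hd
  haveI := isDomain_quot c t hz hd
  haveI : IsDomain (B ⧸ Ideal.span {algebraMap R B (c 0)}) :=
    (blowupAlgebraQuotEquiv c 0 hc).toMulEquiv.isDomain_iff.mp inferInstance
  have hne : algebraMap R B (c 0) ≠ 0 := by
    haveI := isDomain_chart c (c0_ne_zero c t hz hd)
    exact nonZeroDivisors.ne_zero
      (algebraMap_mem_nonZeroDivisors_blowupAlgebra : algebraMap R B (c 0) ∈ nonZeroDivisors B)
  exact (Ideal.span_singleton_prime hne).mp ((Ideal.Quotient.isDomain_iff_prime _).mp inferInstance)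
end Quot

/-! ## The equation `g`: `c₀ ∤ g` in `B`, and `𝔮 = 𝔪_R B` is prime -/

section Equation

variable {c t} (g ε : R) (hε : IsUnit ε) (hgt : g - ε * t ^ 2 ∈ Ideal.span (Set.range c))

include hz hd hε hgt in
/-- **`c₀ ∤ g` in `B`**: the image of `g` in `B/(c₀) ≅ (R/(c₀,c₁))[T]` is the constant `ε̄·t̄² ≠ 0`. [folklore] -/
theorem not_dvd_algebraMap_g : ¬ algebraMap R B (c 0) ∣ algebraMap R B g := by
  intro hdvd
  have hc := isQuasiRegular_centre c ![t] hz hd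
  have h0 : Ideal.Quotient.mk (Ideal.span {algebraMap R B (c 0)}) (algebraMap R B g) = 0 :=
    Ideal.Quotient.eq_zero_iff_mem.mpr (Ideal.mem_span_singleton.mpr hdvd)
  have h1 := congrArg (blowupAlgebraQuotEquiv c 0 hc).symm h0
  rw [quotEquiv_symm_mk_algebraMap, map_zero, MvPolynomial.C_eq_zero, Ideal.Quotient.eq_zero_iff_mem] at h1
  have h2 : ε * t ^ 2 ∈ I := by
    have := Ideal.sub_mem _ h1 hgt
    rwa [sub_sub_cancel] at this
  have hprime := isPrime_span c t hz hd
  rcases hprime.mem_or_mem h2 with h | h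
  · exact hprime.ne_top (Ideal.eq_top_of_isUnit_mem _ h hε)
  · exact t_notMem_span c t hz hd (hprime.mem_of_pow_mem 2 h)

include hz hd hε hgt in
/-- `g ≠ 0` in `B`. [folklore] -/
theorem algebraMap_g_ne_zero : algebraMap R B g ≠ 0 := fun h =>
  not_dvd_algebraMap_g hz hd g ε hε hgt (h ▸ dvd_zero _)
end Equation

include hz hd in
/-- **`𝔮 := 𝔪_R · B` is a prime ideal of `B`**: modulo `c₀` it becomes the ideal `(𝔪/I)·(R/I)[T]` of constants of
`(R/I)[T]`, `I = (c₀, c₁)`, whose quotient is the polynomial ring `(R/𝔪)[T]` over the residue field. [folklore] -/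
theorem isPrime_map_maximalIdeal : ((maximalIdeal R).map (algebraMap R B)).IsPrime := by
  have hc := isQuasiRegular_centre c ![t] hz hd
  have hIm : I ≤ maximalIdeal R := (isRsopPart_centre c ![t] hz hd).span_range_le_maximalIdeal
  -- the ideal `𝔞 = 𝔪/I` of `R/I` has quotient the residue field
  set 𝔞 : Ideal (R ⧸ I) := (maximalIdeal R).map (Ideal.Quotient.mk I) with h𝔞
  haveI : IsDomain ((R ⧸ I) ⧸ 𝔞) := by
    have e₁ : ((R ⧸ I) ⧸ 𝔞) ≃+* R ⧸ maximalIdeal R :=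
      (DoubleQuot.quotQuotEquivQuotSup I (maximalIdeal R)).trans (Ideal.quotEquivOfEq (sup_eq_right.mpr hIm))
    exact e₁.toMulEquiv.isDomain_iff.mpr inferInstance
  -- `𝔫 = 𝔞·(R/I)[T]` is prime
  have h𝔫 : (𝔞.map (MvPolynomial.C : R ⧸ I →+* MvPolynomial {j : Fin 2 // j ≠ 0} (R ⧸ I))).IsPrime := by
    have hk : RingHom.ker (Ideal.Quotient.mk 𝔞) = 𝔞 := Ideal.mk_ker
    rw [← hk, ← MvPolynomial.ker_map]
    exact RingHom.ker_isPrime _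
  -- transport along `e : (R/I)[T] ≅ B/(c₀)`
  set e := blowupAlgebraQuotEquiv c 0 hc with he
  set mkB := Ideal.Quotient.mk (Ideal.span {algebraMap R B (c 0)}) with hmkB
  set 𝔮 : Ideal B := (maximalIdeal R).map (algebraMap R B) with h𝔮
  have hcomp : ((e.symm : B₀ →+* P₂).comp mkB).comp (algebraMap R B) =
      (MvPolynomial.C : R ⧸ I →+* P₂).comp (Ideal.Quotient.mk I) := by
    refine RingHom.ext fun r => ?_
    exact quotEquiv_symm_mk_algebraMap hc r
  have hq' : (𝔮.map mkB).map (e.symm : B₀ →+* P₂) = 𝔞.map MvPolynomial.C := by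
    rw [h𝔮, h𝔞, Ideal.map_map, Ideal.map_map, hcomp, ← Ideal.map_map]
  have hq'p : (𝔮.map mkB).IsPrime := by
    have h2 : 𝔮.map mkB = (𝔞.map MvPolynomial.C).map (e.symm.symm : P₂ →+* B₀) := by
      rw [← hq', Ideal.map_of_equiv]
    rw [h2]
    refine Ideal.map_isPrime_of_surjective e.symm.symm.surjective ?_
    rw [(RingHom.injective_iff_ker_eq_bot _).mp e.symm.symm.injective]
    exact bot_le
  -- pull back along `B → B/(c₀)`
  have hle : RingHom.ker mkB ≤ 𝔮 := by
    rw [hmkB, Ideal.mk_ker, Ideal.span_singleton_le_iff_mem]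
    exact Ideal.mem_map_of_mem _ ((isRsopPart_centre c ![t] hz hd).mem_maximalIdeal 0)
  have h3 : (𝔮.map mkB).comap mkB = 𝔮 := by
    rw [Ideal.comap_map_of_surjective _ Ideal.Quotient.mk_surjective, ← RingHom.ker_eq_comap_bot,
      sup_eq_left.mpr hle]
  rw [← h3]
  exact Ideal.IsPrime.comap _

/-! ## Localisation of a quotient at the image of a prime -/

omit [IsRegularLocalRing R] in
/-- **`C_{θ(𝔮)} ≅ B_𝔮 / (ker θ) B_𝔮`** for a surjection `θ : B ↠ C` and a prime `𝔮 ⊇ ker θ` (localisation commutes with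
quotients; instance form `isLocalization_atPrime_quotient_of_surjective`, p535712). [folklore] -/
theorem nonempty_ringEquiv_localization_map {B' C : Type*} [CommRing B'] [CommRing C] (θ : B' →+* C)
    (hθ : Function.Surjective θ) (𝔮 : Ideal B') [𝔮.IsPrime] (hker : RingHom.ker θ ≤ 𝔮) :
    haveI : (𝔮.map θ).IsPrime := Ideal.map_isPrime_of_surjective hθ hker
    Nonempty (Localization.AtPrime (𝔮.map θ) ≃+*
      Localization.AtPrime 𝔮 ⧸ (RingHom.ker θ).map (algebraMap B' (Localization.AtPrime 𝔮))) := by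
  haveI : (𝔮.map θ).IsPrime := Ideal.map_isPrime_of_surjective hθ hker
  set D := Localization.AtPrime 𝔮
  have hlift : ∀ a ∈ RingHom.ker θ, ((Ideal.Quotient.mk ((RingHom.ker θ).map (algebraMap B' D))).comp
      (algebraMap B' D)) a = 0 := fun a ha =>
    Ideal.Quotient.eq_zero_iff_mem.mpr (Ideal.mem_map_of_mem _ ha)
  let φ : C →+* D ⧸ (RingHom.ker θ).map (algebraMap B' D) :=
    (Ideal.Quotient.lift (RingHom.ker θ) _ hlift).comp (RingHom.quotientKerEquivOfSurjective hθ).symm.toRingHom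
  have hφ : ∀ b, φ (θ b) = Ideal.Quotient.mk _ (algebraMap B' D b) := by
    intro b
    change Ideal.Quotient.lift (RingHom.ker θ) _ hlift ((RingHom.quotientKerEquivOfSurjective hθ).symm (θ b)) = _
    rw [RingHom.quotientKerEquivOfSurjective_symm_apply, Ideal.Quotient.lift_mk, RingHom.comp_apply]
  have hloc := TCPlus.isLocalization_atPrime_quotient_of_surjective θ hθ 𝔮 hker φ hφ
  letI := φ.toAlgebra
  exact ⟨(IsLocalization.algEquiv (𝔮.map θ).primeCompl (Localization.AtPrime (𝔮.map θ))
    (D ⧸ (RingHom.ker θ).map (algebraMap B' D))).toRingEquiv⟩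

/-! ## K-RIBBON -/

section Main

variable {c t} (g ε : R) (hε : IsUnit ε) (hg2 : g ∈ maximalIdeal R ^ 2)
  (hgt : g - ε * t ^ 2 ∈ Ideal.span (Set.range c))

local notation3 "mkg" => Ideal.Quotient.mk (Ideal.span {g})

include hε hgt in
omit [IsRegularLocalRing R] in
/-- **The trace of a ribbon centre**: modulo `g`, `(c₀, c₁, s·t^m) = (c₀, c₁)` for `m ≥ 2` (because `t̄² = ε⁻¹·(εt² − g)‾`
lies in `(c̄₀, c̄₁)`). [folklore] -/
theorem trace_eq {m : ℕ} (hm : 2 ≤ m) (s : R) :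
    (Ideal.span (Set.range c) ⊔ Ideal.span {s * t ^ m}).map mkg = (Ideal.span (Set.range c)).map mkg := by
  refine le_antisymm ?_ (Ideal.map_mono le_sup_left)
  rw [Ideal.map_sup, sup_le_iff]
  refine ⟨le_rfl, ?_⟩
  rw [Ideal.map_span, Set.image_singleton, Ideal.span_singleton_le_iff_mem]
  -- `t̄² ∈ Ī`
  have ht2 : mkg (ε * t ^ 2) ∈ (I).map mkg := by
    have h1 : mkg (ε * t ^ 2) = mkg (ε * t ^ 2 - g) := by
      rw [map_sub, Ideal.Quotient.eq_zero_iff_mem.mpr (Ideal.mem_span_singleton_self g), sub_zero]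
    rw [h1]
    refine Ideal.mem_map_of_mem _ ?_
    have := Submodule.neg_mem _ hgt
    rwa [neg_sub] at this
  obtain ⟨u, hu⟩ := hε
  have ht2' : mkg (t ^ 2) ∈ (I).map mkg := by
    have : mkg (t ^ 2) = mkg (↑u⁻¹ : R) * mkg (ε * t ^ 2) := by
      rw [← map_mul, ← hu, ← mul_assoc, Units.inv_mul, one_mul]
    rw [this]
    exact Ideal.mul_mem_left _ _ ht2
  obtain ⟨k, rfl⟩ := Nat.exists_eq_add_of_le hm
  have : mkg (s * t ^ (2 + k)) = mkg (s * t ^ k) * mkg (t ^ 2) := by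
    rw [← map_mul]; ring_nf
  rw [this]
  exact Ideal.mul_mem_left _ _ ht2'

include hz hd hε hg2 hgt in
/-- **K-RIBBON (res-L1-w45b-strat-1 STRATEGY-CENSUS v10 N5.1, ring form).** `R` regular local of dimension `3` with regular
system of parameters `(c₀, c₁, t)`; `g ∈ 𝔪²` with `g ≡ ε t² (mod (c₀, c₁))`, `ε` a unit; `A = R/(g)`. Then the `c̄₀`-chart
`A[(c̄₀, c̄₁)/c̄₀]` of the blow-up of `Spec A` along `(c̄₀, c̄₁)` (= the trace of every ribbon centre, `trace_eq`) has a prime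
`𝔓` lying over `𝔪_A` at which it is NOT regular: `𝔓 = θ(𝔪_R·B)`, local ring `B_𝔮/(g)` with `0 ≠ g ∈ 𝔮²`.
A ribbon touch at an anisotropic good 2-dimensional germ is never the finishing touch. OURS. -/
theorem exists_prime_not_isRegularLocalRing :
    ∃ (𝔓 : Ideal (blowupAlgebra ((Ideal.span (Set.range c)).map mkg) (mkg (c 0)))) (_ : 𝔓.IsPrime),
        𝔓.comap (algebraMap (R ⧸ Ideal.span {g}) (blowupAlgebra ((Ideal.span (Set.range c)).map mkg) (mkg (c 0)))) =
          (maximalIdeal R).map mkg ∧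
        ¬ IsRegularLocalRing (Localization.AtPrime 𝔓) := by
  haveI hB := isRegularRing_chart c t hz hd
  haveI := isDomain_chart c (c0_ne_zero c t hz hd)
  -- the prime `𝔮 = 𝔪_R B`
  set 𝔮 : Ideal B := (maximalIdeal R).map (algebraMap R B) with h𝔮
  haveI h𝔮p : 𝔮.IsPrime := isPrime_map_maximalIdeal c t hz hd
  -- the chart of the strict transform: `B/(g)`
  set θ := blowupAlgebra.mapQuotient I (c 0) (Ideal.span {g}) with hθ
  have hθs : Function.Surjective θ := blowupAlgebra.mapQuotient_surjective _ _ _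
  have hker : RingHom.ker θ = Ideal.span {algebraMap R B g} :=
    blowupAlgebra.ker_mapQuotient_eq_span I (c 0) (n := 0) (f' := algebraMap R B g)
      (by rw [pow_zero, one_mul]) (prime_algebraMap_c0 hz hd) (not_dvd_algebraMap_g hz hd g ε hε hgt)
  have hgm : g ∈ maximalIdeal R := Ideal.pow_le_self two_ne_zero hg2
  have hker𝔮 : RingHom.ker θ ≤ 𝔮 := by
    rw [hker, Ideal.span_singleton_le_iff_mem]
    exact Ideal.mem_map_of_mem _ hgm
  set 𝔓 := 𝔮.map θ with h𝔓
  haveI h𝔓p : 𝔓.IsPrime := Ideal.map_isPrime_of_surjective hθs hker𝔮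
  refine ⟨𝔓, h𝔓p, ?_, ?_⟩
  · -- `𝔓` lies over `𝔪_A`
    have hmaxA : ((maximalIdeal R).map mkg).IsMaximal :=
      Ideal.IsMaximal.map_of_surjective_of_ker_le Ideal.Quotient.mk_surjective
        (by rw [Ideal.mk_ker, Ideal.span_singleton_le_iff_mem]; exact hgm)
    refine (hmaxA.eq_of_le (Ideal.IsPrime.comap _).ne_top ?_).symm
    rw [Ideal.map_le_iff_le_comap]
    intro r hr
    rw [Ideal.mem_comap, Ideal.mem_comap, ← blowupAlgebra.mapQuotient_algebraMap]
    exact Ideal.mem_map_of_mem _ (Ideal.mem_map_of_mem _ hr)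
  · -- the local ring at `𝔓` is `B_𝔮/(g)`, not regular
    haveI hDreg : IsRegularLocalRing (Localization.AtPrime 𝔮) := IsRegularRing.isRegularLocalRing_localization 𝔮
    obtain ⟨eqv⟩ := nonempty_ringEquiv_localization_map θ hθs 𝔮 hker𝔮
    have hmapker : (RingHom.ker θ).map (algebraMap B (Localization.AtPrime 𝔮)) =
        Ideal.span {algebraMap B (Localization.AtPrime 𝔮) (algebraMap R B g)} := by
      rw [hker, Ideal.map_span, Set.image_singleton]
    -- `0 ≠ g ∈ 𝔪_{B_𝔮}²`
    have hg0 : algebraMap B (Localization.AtPrime 𝔮) (algebraMap R B g) ≠ 0 := by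
      intro h0
      apply algebraMap_g_ne_zero hz hd g ε hε hgt
      exact IsLocalization.injective (Localization.AtPrime 𝔮) 𝔮.primeCompl_le_nonZeroDivisors (by rw [h0, map_zero])
    have hgD2 : algebraMap B (Localization.AtPrime 𝔮) (algebraMap R B g) ∈
        maximalIdeal (Localization.AtPrime 𝔮) ^ 2 := by
      rw [← Localization.AtPrime.map_eq_maximalIdeal, ← Ideal.map_pow]
      refine Ideal.mem_map_of_mem _ ?_
      rw [h𝔮, ← Ideal.map_pow]
      exact Ideal.mem_map_of_mem _ hg2
    have hnot := @not_isRegularLocalRing_quotient_span_singleton_of_mem_sq _ _ hDreg _ hg0 hgD2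
    intro hreg
    haveI := hreg
    exact hnot (IsRegularLocalRing.of_ringEquiv (eqv.trans (Ideal.quotEquivOfEq hmapker)))
end Main

/-! ## Named form: regular system of parameters `(u₁, u₂, t)`, `dim R = 3` -/

section Named

omit [CommRing R] [IsRegularLocalRing R] in
/-- `range (u₁, u₂ ; t) = {u₁, u₂, t}`. [folklore] -/
theorem range_append_vec (u₁ u₂ t : R) : Set.range (Fin.append ![u₁, u₂] ![t]) = {u₁, u₂, t} := by
  ext x
  simp only [Set.mem_range, Set.mem_insert_iff, Set.mem_singleton_iff]
  constructor
  · rintro ⟨i, rfl⟩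
    induction i using Fin.addCases with
    | left j =>
      rw [Fin.append_left]
      fin_cases j <;> simp
    | right k =>
      rw [Fin.append_right]
      fin_cases k; simp
  · rintro (rfl | rfl | rfl)
    · exact ⟨Fin.castAdd 1 0, by rw [Fin.append_left]; rfl⟩
    · exact ⟨Fin.castAdd 1 1, by rw [Fin.append_left]; rfl⟩
    · exact ⟨Fin.natAdd 2 0, by rw [Fin.append_right]; rfl⟩

omit [CommRing R] [IsRegularLocalRing R] in
/-- `range (u₁, u₂) = {u₁, u₂}`. [folklore] -/
theorem range_vec_two (u₁ u₂ : R) : Set.range ![u₁, u₂] = {u₁, u₂} := by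
  ext x
  simp only [Set.mem_range, Set.mem_insert_iff, Set.mem_singleton_iff]
  constructor
  · rintro ⟨i, rfl⟩
    fin_cases i <;> simp
  · rintro (rfl | rfl)
    · exact ⟨0, rfl⟩
    · exact ⟨1, rfl⟩

/-- **K-RIBBON, named form (res-L1-w45b-strat-1 STRATEGY-CENSUS v10 N5.1 / R2″ verbatim).** `R` regular local of dimension
`3` with `𝔪 = (u₁, u₂, t)`; `g ∈ 𝔪²` with `g − ε t² ∈ (u₁, u₂)`, `ε` a unit; `A = R/(g)`. Then the chart `A[(ū₁, ū₂)/ū₁]` of the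
blow-up of `Spec A` along `(ū₁, ū₂)` has a prime over `𝔪_A` at which it is not regular. OURS. -/
theorem exists_prime_not_isRegularLocalRing_of_span_eq (u₁ u₂ t : R) (hm : maximalIdeal R = Ideal.span {u₁, u₂, t})
    (hdim : ringKrullDim R = 3) (g ε : R) (hε : IsUnit ε) (hg2 : g ∈ maximalIdeal R ^ 2)
    (hgt : g - ε * t ^ 2 ∈ Ideal.span {u₁, u₂}) :
    ∃ (𝔓 : Ideal (blowupAlgebra ((Ideal.span {u₁, u₂}).map (Ideal.Quotient.mk (Ideal.span {g})))
        (Ideal.Quotient.mk (Ideal.span {g}) u₁))) (_ : 𝔓.IsPrime),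
      𝔓.comap (algebraMap (R ⧸ Ideal.span {g}) _) = (maximalIdeal R).map (Ideal.Quotient.mk (Ideal.span {g})) ∧
        ¬ IsRegularLocalRing (Localization.AtPrime 𝔓) := by
  have hz : Ideal.span (Set.range (Fin.append ![u₁, u₂] ![t])) = maximalIdeal R := by
    rw [range_append_vec, hm]
  have hd : (maximalIdeal R).spanFinrank = 2 + 1 := by
    have h := IsRegularLocalRing.spanFinrank_maximalIdeal (R := R)
    rw [hdim] at h
    exact_mod_cast h
  have hgt' : g - ε * t ^ 2 ∈ Ideal.span (Set.range ![u₁, u₂]) := by rwa [range_vec_two]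
  have key := exists_prime_not_isRegularLocalRing hz hd g ε hε hg2 hgt'
  rw [range_vec_two] at key
  exact key
end Named

end RibbonTouch

end Summit.ResolutionOfSingularities.ResolutionOfSingularities.Cruxes.EquisingularLiftNat.Sections
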